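import Literature.Computability.Complexity.HardLangMachine
import Literature.Computability.Complexity.WorstCaseToMildFunction
import HarnessLib

/-!
# The IKW generator as a machine, I: the low-degree-extension bits from a TABLE (table-oracle variant
# of `HardLangMachine.lean`)

Topic `Computability/Complexity`. First part of the `FP` string function computing the pseudorandom
generator of Impagliazzo–Kabanets–Wigderson 2002, Thm. 11 (`IKWGen.genPad`, `IKWTableGenerator.lean`)
from the truth table of the hard function (`tableGenerator`, `HardnessVsRandomness.lean`). The innermost
function of that generator is the mildly hard function `MildHardFn.mildFn f₀ η hm`
(`WorstCaseToMildFunction.lean`): the bits of the low-degree extension over `GF(2^{M+1})` of the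
zero-padded `f₀`. `HardLangMachine.lean` computes exactly these bits for a LANGUAGE, the cube function
being answered by the clocked universal machine on the code of an `E`-machine (`HardLangM.extF e Q`,
`HardLangM.coreF e Q`); here the cube function is answered by READING A TABLE carried in the input, and
everything else — field arithmetic, the modulus search, Lagrange indicators, block products, the one-hot
selection (`HardLangM.termF`, `modSearchF`, `cEta … cEnv`, `onesCountF`, `selF`) — is reused verbatim:

* T1 `tblF` — the table oracle on `⟨u, P⟩`, `P = tctx N m r = ⟨1ᴺ, ⟨1ᵐ, r⟩⟩`: the bit of `r` at the number
  written (little-endian) by the first `m` symbols of `u` (`tableFn m r u`, `tblF_apply`);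
* T2 `extPieceTF`, `extTF` — the cube sum of `HardLangM.extF` with the oracle call replaced by `tblF`
  (`extTF_apply`: value `bits M (SelfCorrect.ext (cubeFnOf η k (tableFn m r)) z)`, fuel `N ≥ 2^{kη}`);
* T3 `coreTF` — the core of `HardLangM.coreF` over `extTF` (`cBricks_apply'`: the parameter bricks on a
  general pad; `coreTF_apply`: value `[hardBitT m r x]`, the hard bit of the cube function `tableFn m r` at
  the scale of `|x|`);
* T4 the identification with the mathematical side: `etaOf_lenOf`, `bitsToNat_ofFn`,
  `cubeFnOf_tableFn` (the cube function read off `truthTable f₀` IS the padded source function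
  `MildHardFn.srcFn f₀ η hm`), **`coreTF_ofFn`**: on `⟨List.ofFn w', tctx N m (truthTable f₀)⟩` with
  `N ≥ 2^{lenOf η}` the core returns `[MildHardFn.mildFn f₀ η hm w']`.

## References

* R. Impagliazzo, V. Kabanets, A. Wigderson, *In search of an easy witness: exponential time vs.
  probabilistic polynomial time*, JCSS 65 (2002), Thm. 11 ("there is a polynomial-time computable
  `F`") [ImpagliazzoKabanetsWigderson2002].
* S. Arora, B. Barak, *Computational Complexity: A Modern Approach*, CUP 2009, Thm. 19.21 (proof),
  §19.4.2 [AroraBarakCC2009].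
* L. Babai, L. Fortnow, N. Nisan, A. Wigderson, Comput. Complexity 3 (1993) 307–318, §4.

## Design notes

* Only the ORACLE of `HardLangM.extPieceF` changes; the proofs of `extTF_apply` / `coreTF_apply` are
  those of `HardLangM.extF_apply` / `coreF_apply` with the universal-machine hypothesis `hrun` replaced
  by the value of `tblF` (no new mathematics). `HardLangM.cBricks_apply` is restated for a general pad
  (`cBricks_apply'`) because the table travels in the pad slot.
-/

noncomputable section

namespace Literature.Computability.Complexity

open _root_.Computability Polynomial Brick Plumb GF2Str Literature.InformationTheory.Coding HardLangM

namespace IKWGenM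

/-! ### T1. The table oracle -/

/-- The table pad `⟨1ᴺ, ⟨1ᵐ, r⟩⟩`: fuel `N`, the arity `m` in unary, the truth table `r`. [folklore] -/
def tctx (N m : ℕ) (r : List Bool) : List Bool := boolPair (ones N) (boolPair (ones m) r)

/-- The length of the table pad dominates the fuel. [folklore] -/
theorem le_length_tctx (N m : ℕ) (r : List Bool) : N ≤ (tctx N m r).length := by
  simp only [tctx, length_boolPair, ones, List.length_replicate]; omega

/-- **The cube function read off a table** `r` of a function of `m` variables: the bit of `r` at the
number written, little-endian, by the first `m` symbols of `u` (later symbols are the zero padding of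
Arora–Barak's proof of Thm. 19.21). [cite: AroraBarakCC2009, Thm. 19.21 (proof: padding)] -/
def tableFn (m : ℕ) (r : List Bool) (u : List Bool) : Bool := r.getD (bitsToNat (u.take m)) false

/-- **The table-oracle brick** on `⟨u, ⟨1ᴺ, ⟨1ᵐ, r⟩⟩⟩`: `[tableFn m r u]` (position in unary, capped by
`|r|`, then a positional read normalised to one symbol). [cite: AroraBarak2009, §1.3] -/
def tblF : List Bool → List Bool :=
  iteFn isNilFn (fun _ => [false]) id ∘ bitAtFn ∘
    fanoutFn (binToUnaryFn ∘ fanoutFn (sndF ∘ sndF ∘ sndF) (takeFn ∘ fanoutFn (fstF ∘ sndF ∘ sndF) fstF))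
      (sndF ∘ sndF ∘ sndF)

/-- `tblF ∈ FP`. [folklore] -/
theorem tblF_mem_FP : tblF ∈ FP :=
  comp_mem_FP (iteFn_mem_FP isNilFn_mem_FP (const_mem_FP _) (PolyTimeComputable.id _)) (comp_mem_FP bitAtFn_mem_FP
    (fanoutFn_mem_FP
      (comp_mem_FP binToUnaryFn_mem_FP (fanoutFn_mem_FP (comp_mem_FP sndF_mem_FP (comp_mem_FP sndF_mem_FP sndF_mem_FP))
        (comp_mem_FP takeFn_mem_FP (fanoutFn_mem_FP (comp_mem_FP fstF_mem_FP (comp_mem_FP sndF_mem_FP sndF_mem_FP)) fstF_mem_FP))))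
      (comp_mem_FP sndF_mem_FP (comp_mem_FP sndF_mem_FP sndF_mem_FP))))

/-- **Value of the table oracle.** [folklore] -/
theorem tblF_apply (u : List Bool) (N m : ℕ) (r : List Bool) : tblF (boolPair u (tctx N m r)) = [tableFn m r u] := by
  rw [tblF, Function.comp_apply, Function.comp_apply]
  simp only [fanoutFn_apply, Function.comp_apply, tctx, sndF_boolPair, fstF_boolPair, takeFn_boolPair, ones,
    List.length_replicate, binToUnaryFn_boolPair, bitAtFn_boolPair]
  rcases lt_or_ge (bitsToNat (u.take m)) r.length with h | h
  · rw [min_eq_left h.le, List.take_one_drop_eq_of_lt_length h, iteFn_apply (b := false) (by rfl)]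
    change [r[bitsToNat (u.take m)]] = [tableFn m r u]
    rw [tableFn, List.getD_eq_getElem _ _ h]
  · rw [min_eq_right h, List.drop_eq_nil_of_le le_rfl, List.take_nil, iteFn_apply (b := true) (by rfl)]
    change [false] = [tableFn m r u]
    rw [tableFn, List.getD_eq_default _ _ h]

/-! ### T2. The cube sum with the table oracle (`HardLangM.extF` with `tblF` for the oracle) -/

section Ext

variable (M η k : ℕ)

/-- **The cube-point piece** on `⟨⟨⟨Z, env⟩, ⟨1ⁿ, P⟩⟩, 1ʲ⟩` (`n = kη`, `P` the table pad): the block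
product of the cube point `a = natBits n j` if the table says `a ↦ 1`, else `[]` — `HardLangM.extPieceF`
with the oracle call replaced by `tblF`. [folklore] -/
def extPieceTF : List Bool → List Bool :=
  iteFn (tblF ∘ fanoutFn aStrF (sndF ∘ sndF ∘ fstF))
    (termF ∘ fanoutFn (fanoutFn aStrF (fstF ∘ fstF ∘ fstF)) (sndF ∘ fstF ∘ fstF))
    fun _ => []

/-- `extPieceTF ∈ FP`. [folklore] -/
theorem extPieceTF_mem_FP : extPieceTF ∈ FP :=
  iteFn_mem_FP (comp_mem_FP tblF_mem_FP (fanoutFn_mem_FP aStrF_mem_FP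
      (comp_mem_FP sndF_mem_FP (comp_mem_FP sndF_mem_FP fstF_mem_FP))))
    (comp_mem_FP termF_mem_FP (fanoutFn_mem_FP (fanoutFn_mem_FP aStrF_mem_FP (comp_mem_FP fstF_mem_FP (comp_mem_FP fstF_mem_FP fstF_mem_FP)))
      (comp_mem_FP sndF_mem_FP (comp_mem_FP fstF_mem_FP fstF_mem_FP)))) (const_mem_FP _)

/-- **Value of the cube-point piece** (table pad `tctx N m r`, cube function `tableFn m r`). [folklore] -/
theorem extPieceTF_apply (hM : 1 ≤ M) (hη : η ≤ M + 1) (hkη : 2 ^ η ≤ k) (z : Fin k → GF2 M) (R : List Bool)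
    (N m : ℕ) (r : List Bool) {j : ℕ} (hj : j < 2 ^ (k * η)) :
    extPieceTF (boolPair (eCtx η k (zFlat M k z) (env η k (modStr M) R) (tctx N m r)) (ones j)) =
      if tableFn m r (natBits (k * η) j) then bits M (∏ i ∈ Finset.range k, factorOf M η k j z i) else [] := by
  have ha := aStrF_apply (zFlat M k z) (env η k (modStr M) R) (tctx N m r) hj
  have hc : (tblF ∘ fanoutFn aStrF (sndF ∘ sndF ∘ fstF))
      (boolPair (eCtx η k (zFlat M k z) (env η k (modStr M) R) (tctx N m r)) (ones j)) = [tableFn m r (natBits (k * η) j)] := by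
    rw [Function.comp_apply, fanoutFn_apply, eCtx, ha]
    simp only [Function.comp_apply, fstF_boolPair, sndF_boolPair]
    exact tblF_apply _ N m r
  rw [extPieceTF, iteFn_apply hc]
  split_ifs with h
  · rw [Function.comp_apply, fanoutFn_apply, fanoutFn_apply, eCtx, ha]
    simp only [Function.comp_apply, fstF_boolPair, sndF_boolPair]
    exact termF_apply M η k hM hη hkη j z R
  · rfl

/-- **The cube-sum brick** `extTF`: xor-accumulate the cube-point pieces over all `2ⁿ` cube points
(`HardLangM.extF` with the table oracle; the initialisation `HardLangM.extInitF` is reused). [folklore] -/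
def extTF : List Bool → List Bool := sndPow 2 ∘ foldLoop xorF (clipF 1 extPieceTF) X ∘ extInitF

/-- `extTF ∈ FP`. [folklore] -/
theorem extTF_mem_FP : extTF ∈ FP :=
  comp_mem_FP (sndPow_mem_FP 2) (comp_mem_FP
    (foldLoop_clipF_mem_FP 1 xorF_mem_FP length_xorF_le extPieceTF_mem_FP _) extInitF_mem_FP)

/-- **Value of the cube-sum brick**: the bits of the extension `P(z)` of the cube function `tableFn m r`
(`N ≥ 2ⁿ` so that the pad pays for the `2ⁿ` rounds). The proof is that of `HardLangM.extF_apply`.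
[cite: AroraBarakCC2009, §19.4.2] -/
theorem extTF_apply (hM : 1 ≤ M) (hη : η ≤ M + 1) (hkη : 2 ^ η ≤ k) (z : Fin k → GF2 M) (R : List Bool)
    {N : ℕ} (hN : 2 ^ (k * η) ≤ N) (m : ℕ) (r : List Bool) :
    extTF (eCtx η k (zFlat M k z) (env η k (modStr M) R) (tctx N m r)) =
      bits M (SelfCorrect.ext (cubeFnOf η k (tableFn m r)) z) := by
  set G : List Bool → Bool := tableFn m r with hG
  have hf := (modStr_top M).1
  set x := eCtx η k (zFlat M k z) (env η k (modStr M) R) (tctx N m r) with hx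
  have hNP := le_length_tctx N m r
  have hk : 2 ^ (k * η) ≤ (X : Polynomial ℕ).eval x.length := by
    simp only [eval_X, hx, eCtx, length_boolPair, ones, List.length_replicate]; omega
  have hloop := foldLoop_apply xorF (clipF 1 extPieceTF) hk 0 (List.replicate (M + 1) false)
  rw [show ones 0 = ([] : List Bool) from rfl] at hloop
  have hpiece : ∀ j, j < 2 ^ (k * η) → extPieceTF (boolPair x (ones j)) =
      if G (natBits (k * η) j) then bits M (∏ i ∈ Finset.range k, factorOf M η k j z i) else [] :=
    fun j hj => by rw [hx, hG]; exact extPieceTF_apply M η k hM hη hkη z R N m r hj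
  rw [extTF, Function.comp_apply, Function.comp_apply, hx, extInitF_apply M η k _ _ R _ hf, ← hx, hloop, sndPow_succ_boolPair,
    sndPow_succ_boolPair, sndPow_zero_boolPair, foldAcc_clipF (fun j _ hj => by
      rw [hpiece j (by omega)]
      split_ifs
      · rw [length_bits]; simp only [hx, eCtx, env, length_boolPair]; omega
      · simp)]
  rw [foldAcc_eq_foldl xorF extPieceTF x xorStr
    (fun j => if G (natBits (k * η) j) then bits M (∏ i ∈ Finset.range k, factorOf M η k j z i) else []) _ _ _
    (fun a j _ _ => xorF_apply _ _) (fun j _ hj => hpiece j (by omega))]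
  -- the xor-accumulation computes the sum of the terms
  set T : ℕ → GF2 M := fun j => SelfCorrect.bitF M (cubeFnOf η k G (SelfCorrect.rows k η (bitsOf (k * η) j))) *
    ∏ i : Fin k, (MetaComplexity.cubeBasis (SelfCorrect.cubePt η M) (SelfCorrect.rows k η (bitsOf (k * η) j) i)).eval (z i) with hT
  have hterm : ∀ j, (∏ i ∈ Finset.range k, factorOf M η k j z i) =
      ∏ i : Fin k, (MetaComplexity.cubeBasis (SelfCorrect.cubePt η M) (SelfCorrect.rows k η (bitsOf (k * η) j) i)).eval (z i) := by
    intro j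
    rw [← Fin.prod_univ_eq_prod_range]
    refine Fintype.prod_congr _ _ fun i => ?_
    rw [factorOf, dif_pos i.isLt, rows_bitsOf]
  have hfold : ∀ n, (List.range' 0 n).foldl (fun acc j => xorStr acc
      (if G (natBits (k * η) j) then bits M (∏ i ∈ Finset.range k, factorOf M η k j z i) else []))
      (List.replicate (M + 1) false) = bits M (∑ j ∈ Finset.range n, T j) := by
    intro n
    induction n with
    | zero => rw [List.range'_zero, List.foldl_nil, Finset.sum_range_zero, bits_zero]
    | succ n ih =>
      rw [List.range'_1_concat, List.foldl_append, List.foldl_cons, List.foldl_nil, ih, Finset.sum_range_succ, Nat.zero_add]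
      have hGn : G (natBits (k * η) n) = cubeFnOf η k G (SelfCorrect.rows k η (bitsOf (k * η) n)) := by
        rw [cubeFnOf_rows, ofFn_bitsOf]
      by_cases hg : G (natBits (k * η) n) = true
      · rw [if_pos hg, hterm, xorStr_bits]
        congr 2
        rw [hT]; simp only [← hGn, hg, SelfCorrect.bitF, if_true, one_mul]
      · rw [if_neg hg, xorStr_nil_right]
        congr 1
        rw [hT]; simp only [Bool.not_eq_true] at hg; simp only [← hGn, hg, SelfCorrect.bitF]; simp
  rw [hfold, SelfCorrect.ext, MetaComplexity.lowDegExt]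
  congr 1
  exact sum_range_rows_bitsOf η k (fun a => SelfCorrect.bitF M (cubeFnOf η k G a) *
    ∏ i : Fin k, (MetaComplexity.cubeBasis (SelfCorrect.cubePt η M) (a i)).eval (z i))

end Ext

/-! ### T3. The core: parameters, the one-hot selection, the selected bit -/

section Core

/-- **Values of the parameter bricks of `HardLangMachine.lean` on a general pad** `P` with
`|P| ≥ 2^{|x|}` (restatement of `HardLangM.cBricks_apply`, whose pad is `1ᴺ`; only the fuel of the
modulus search reads the pad, through its length). [folklore] -/
theorem cBricks_apply' (x P : List Bool) (hP : 2 ^ x.length ≤ P.length) {η : ℕ} (hη : MildHard.etaOf x.length = η)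
    (hlen : MildHard.lenOf η ≤ x.length) :
    cEta (boolPair x P) = ones η ∧
    cM1 (boolPair x P) = ones (MildHard.MOf η + 1) ∧
    cK (boolPair x P) = ones (MildHard.kOf η) ∧
    cF (boolPair x P) = modStr (MildHard.MOf η) ∧
    cZL (boolPair x P) = ones (MildHard.kOf η * (MildHard.MOf η + 1)) ∧
    cZ (boolPair x P) = x.take (MildHard.kOf η * (MildHard.MOf η + 1)) ∧
    cR (boolPair x P) = (x.drop (MildHard.kOf η * (MildHard.MOf η + 1))).take (MildHard.MOf η + 1) ∧
    cN (boolPair x P) = ones (MildHard.kOf η * η) ∧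
    cEnv (boolPair x P) = env η (MildHard.kOf η) (modStr (MildHard.MOf η)) [] := by
  have hEta : cEta (boolPair x P) = ones η := by rw [cEta, Function.comp_apply, fstF_boolPair, etaOfF_apply, hη]
  have hM1 : cM1 (boolPair x P) = ones (MildHard.MOf η + 1) := by
    simp only [cM1, Function.comp_apply, fanoutFn_apply, hEta, appF_boolPair, ones, MildHard.MOf_succ]
    rw [← List.replicate_add, show [true, true] = List.replicate 2 true from rfl, ← List.replicate_add]; ring_nf
  have hklen : MildHard.kOf η ≤ x.length := by
    have : MildHard.kOf η ≤ MildHard.lenOf η := by unfold MildHard.lenOf; nlinarith [Nat.zero_le (MildHard.kOf η)]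
    omega
  have hK : cK (boolPair x P) = ones (MildHard.kOf η) := by
    simp only [cK, Function.comp_apply, fanoutFn_apply, hEta, fstF_boolPair, Kannan.zerosFn_apply, ones, List.length_replicate,
      binToUnaryFn_boolPair, bitsToNat_zeros_append_true, MildHard.kOf]
    rw [min_eq_left (by unfold MildHard.kOf at hklen; exact hklen)]
  have hMlen : 2 * η + 2 ≤ x.length := by
    have : MildHard.MOf η + 1 ≤ MildHard.lenOf η := by unfold MildHard.lenOf; omega
    rw [MildHard.MOf_succ] at this; omega
  have hfuel : 2 ^ (MildHard.MOf η + 1) ≤ P.length := by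
    rw [MildHard.MOf_succ]
    exact le_trans (Nat.pow_le_pow_right (by norm_num) hMlen) hP
  have hF : cF (boolPair x P) = modStr (MildHard.MOf η) := by
    rw [cF, Function.comp_apply, fanoutFn_apply, hM1, sndF_boolPair]
    exact modSearchF_apply _ _ hfuel
  have hZL : cZL (boolPair x P) = ones (MildHard.kOf η * (MildHard.MOf η + 1)) := by
    rw [cZL, Function.comp_apply, fanoutFn_apply, hK, hM1, umulF_apply]
  have hZ : cZ (boolPair x P) = x.take (MildHard.kOf η * (MildHard.MOf η + 1)) := by
    rw [cZ, Function.comp_apply, fanoutFn_apply, hZL, fstF_boolPair, takeFn_boolPair, ones, List.length_replicate]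
  have hR : cR (boolPair x P) = (x.drop (MildHard.kOf η * (MildHard.MOf η + 1))).take (MildHard.MOf η + 1) := by
    simp only [cR, Function.comp_apply, fanoutFn_apply, hM1, hZL, fstF_boolPair, dropFn_boolPair, takeFn_boolPair, ones,
      List.length_replicate]
  have hNn : cN (boolPair x P) = ones (MildHard.kOf η * η) := by
    rw [cN, Function.comp_apply, fanoutFn_apply, hK, hEta, umulF_apply]
  have hEnv : cEnv (boolPair x P) = env η (MildHard.kOf η) (modStr (MildHard.MOf η)) [] := by
    simp only [cEnv, fanoutFn_apply, hF, hEta, hK, env]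
  exact ⟨hEta, hM1, hK, hF, hZL, hZ, hR, hNn, hEnv⟩

/-- The extension bits in context: `extTF` on `⟨⟨Z, env⟩, ⟨1^{kη}, P⟩⟩` assembled from the input `⟨x, P⟩`
(`HardLangM.cE` over `extTF`). [folklore] -/
def cET : List Bool → List Bool := extTF ∘ fanoutFn (fanoutFn cZ cEnv) (fanoutFn cN sndF)

/-- `cET ∈ FP`. [folklore] -/
theorem cET_mem_FP : cET ∈ FP := by
  obtain ⟨_, _, _, _, _, hZ, _, hN, hEnv, _, _⟩ := cBricks_mem_FP [] 0
  exact comp_mem_FP extTF_mem_FP (fanoutFn_mem_FP (fanoutFn_mem_FP hZ hEnv) (fanoutFn_mem_FP hN sndF_mem_FP))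

/-- **The core brick** on `⟨x, P⟩`: valid scale, one-hot selector, and the selected bit of `P(z)`
(`HardLangM.coreF` over `cET`). [folklore] -/
def coreTF : List Bool → List Bool :=
  andFn cValid (andFn (eqPairFn ∘ fanoutFn (onesCountF ∘ cR) fun _ => [true])
    (notFn (isNilFn ∘ selF ∘ fanoutFn cR cET)))

/-- `coreTF ∈ FP`. [folklore] -/
theorem coreTF_mem_FP : coreTF ∈ FP := by
  obtain ⟨_, _, _, _, _, _, hR, _, _, _, hV⟩ := cBricks_mem_FP [] 0
  exact andFn_mem_FP hV (andFn_mem_FP (comp_mem_FP eqPairFn_mem_FP (fanoutFn_mem_FP (comp_mem_FP onesCountF_mem_FP hR) (const_mem_FP _)))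
    (notFn_mem_FP (comp_mem_FP isNilFn_mem_FP (comp_mem_FP selF_mem_FP (fanoutFn_mem_FP hR cET_mem_FP)))))

/-- The core brick is one-bit on every input. [folklore] -/
theorem oneBit_coreTF : OneBit coreTF :=
  oneBit_andFn (oneBit_notFn (oneBit_ltFn.comp _))
    (oneBit_andFn (fun w => by rcases eqPairFn_eq_or (fanoutFn (onesCountF ∘ cR) (fun _ => [true]) w) with h | h <;> exact ⟨_, h⟩)
      (oneBit_notFn (oneBit_isNilFn.comp _)))

/-- The core brick returns at most one symbol. [folklore] -/
theorem length_coreTF_le (w : List Bool) : (coreTF w).length ≤ 1 := by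
  obtain ⟨b, hb⟩ := oneBit_coreTF w
  rw [hb]; simp

/-- **The hard bit of a table**: the hard function of the cube function `tableFn m r` at the scale of the
input length, read off the prefix of length `lenOf η` (the table analogue of `MildHard.hardBit`).
[cite: AroraBarakCC2009, Thm. 19.21] -/
def hardBitT (m : ℕ) (r x : List Bool) : Bool :=
  if MildHard.lenOf (MildHard.etaOf x.length) ≤ x.length then
    SelfCorrect.hardFn (cubeFnOf (MildHard.etaOf x.length) (MildHard.kOf (MildHard.etaOf x.length)) (tableFn m r))
      fun q => x.getD (MildHard.idx (MildHard.etaOf x.length) q) false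
  else false

/-- `hardBitT` at a named scale. [folklore] -/
theorem hardBitT_eq (m : ℕ) (r x : List Bool) {L η : ℕ} (hx : x.length = L) (hη : MildHard.etaOf L = η)
    (h : MildHard.lenOf η ≤ L) :
    hardBitT m r x = SelfCorrect.hardFn (cubeFnOf η (MildHard.kOf η) (tableFn m r)) fun q => x.getD (MildHard.idx η q) false := by
  subst hx; subst hη
  unfold hardBitT
  rw [if_pos h]

/-- **Value of the core brick: the hard bit of the table.** For a pad `P = tctx N m r` with `N ≥ 2^{|x|}`.
The proof is that of `HardLangM.coreF_apply`. [cite: AroraBarakCC2009, Thm. 19.21 (proof)] -/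
theorem coreTF_apply (x : List Bool) {N : ℕ} (hN : 2 ^ x.length ≤ N) (m : ℕ) (r : List Bool) :
    coreTF (boolPair x (tctx N m r)) = [hardBitT m r x] := by
  set P := tctx N m r with hPdef
  have hP : 2 ^ x.length ≤ P.length := hN.trans (le_length_tctx N m r)
  -- the three bits
  rw [coreTF, andFn_apply (cValid_apply x P) (andFn_apply
    (b := decide (onesCountF (cR (boolPair x P)) = [true]))
    (b' := !decide (selF (boolPair (cR (boolPair x P)) (cET (boolPair x P))) = []))
    (by simp only [Function.comp_apply, fanoutFn_apply, eqPairFn_boolPair])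
    (notFn_apply (by simp only [Function.comp_apply, fanoutFn_apply, isNilFn])))]
  by_cases hlen : MildHard.lenOf (MildHard.etaOf x.length) ≤ x.length
  swap
  · -- invalid scale: the hard bit is `0`
    rw [decide_eq_false hlen, Bool.false_and, hardBitT, if_neg hlen]
  rw [decide_eq_true hlen, Bool.true_and]
  set η := MildHard.etaOf x.length with hη
  obtain ⟨hEta, hM1, hK, hF, hZL, hZ, hR, hNn, hEnv⟩ := cBricks_apply' x P hP hη.symm hlen
  have hK' : MildHard.kOf η * (MildHard.MOf η + 1) + (MildHard.MOf η + 1) ≤ x.length := by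
    have : MildHard.lenOf η = MildHard.kOf η * (MildHard.MOf η + 1) + (MildHard.MOf η + 1) := rfl
    omega
  have hM1pos : 1 ≤ MildHard.MOf η := by unfold MildHard.MOf; omega
  have hηM : η ≤ MildHard.MOf η + 1 := by unfold MildHard.MOf; omega
  have hkη : 2 ^ η ≤ MildHard.kOf η := le_of_eq rfl
  have hnm : MildHard.kOf η * η ≤ x.length := by
    have : MildHard.kOf η * η ≤ MildHard.kOf η * (MildHard.MOf η + 1) := Nat.mul_le_mul_left _ hηM
    omega
  -- the bits of the extension
  have hE : cET (boolPair x P) =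
      bits (MildHard.MOf η) (SelfCorrect.ext (cubeFnOf η (MildHard.kOf η) (tableFn m r)) (zOfX (MildHard.MOf η) (MildHard.kOf η) x)) := by
    rw [cET, Function.comp_apply, fanoutFn_apply, fanoutFn_apply, fanoutFn_apply, hZ, hEnv, hNn, sndF_boolPair,
      ← zFlat_zOfX (MildHard.MOf η) (MildHard.kOf η) x (by omega), hPdef]
    exact extTF_apply (MildHard.MOf η) η (MildHard.kOf η) hM1pos hηM hkη _ []
      (le_trans (Nat.pow_le_pow_right (by norm_num) hnm) hN) m r
  -- the selector window and its reads
  have hrlen : ((x.drop (MildHard.kOf η * (MildHard.MOf η + 1))).take (MildHard.MOf η + 1)).length = MildHard.MOf η + 1 := by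
    rw [List.length_take, List.length_drop]; omega
  rw [hR, hE, onesCountF_apply, selF_apply, hrlen, hardBitT_eq m r x rfl hη.symm hlen, SelfCorrect.hardFn]
  -- identify the selector function and the point of the definition
  have hsel : (fun l' : Fin (MildHard.MOf η + 1) => x.getD (MildHard.idx η (Sum.inr l')) false) =
      fun l' : Fin (MildHard.MOf η + 1) => ((x.drop (MildHard.kOf η * (MildHard.MOf η + 1))).take (MildHard.MOf η + 1)).getD l' false := by
    funext l'; rw [getD_take_drop l'.isLt, idx_inr_val]
  have hpt : SelfCorrect.zOf (fun q => x.getD (MildHard.idx η q) false) = zOfX (MildHard.MOf η) (MildHard.kOf η) x := by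
    funext i; simp only [SelfCorrect.zOf, zOfX, idx_inl_val]
  simp only [hsel, hpt, card_range_filter_eq]
  -- the remaining Boolean bookkeeping
  have hones1 : ∀ c : ℕ, (ones c = [true]) ↔ c = 1 := fun c => by
    constructor
    · intro h; have := congrArg List.length h; simpa [ones] using this
    · rintro rfl; rfl
  have hones0 : ∀ c : ℕ, (ones c = []) ↔ c = 0 := fun c => by simp [ones]
  simp only [hones1, hones0, getD_bits]
  rw [onehot_select_eq]

end Core

/-! ### T4. Identification with the mildly hard function of a truth table -/

section Ident

open MetaComplexity

/-- The scale of `lenOf η` is `η`. [folklore] -/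
theorem etaOf_lenOf (η : ℕ) : MildHard.etaOf (MildHard.lenOf η) = η := by
  apply le_antisymm
  · have h := MildHard.lenOf_etaOf_le (m := MildHard.lenOf η) (MildHard.lenOf_strictMono.monotone (Nat.zero_le η))
    exact MildHard.lenOf_strictMono.le_iff_le.1 h
  · exact MildHard.le_etaOf_of_le le_rfl

/-- Reading a listed function inside its range (local helper). [folklore] -/
private theorem getD_ofFn_fin {α : Type*} {L : ℕ} (y : Fin L → α) (d : α) (p : Fin L) : (List.ofFn y).getD p.val d = y p := by
  rw [List.getD_eq_getElem _ _ (by simp), List.getElem_ofFn]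

/-- The little-endian value of a listed bit vector is its `boolFunEquivFin` index. [folklore] -/
theorem bitsToNat_ofFn : ∀ {L : ℕ} (v : Fin L → Bool), bitsToNat (List.ofFn v) = (boolFunEquivFin L v).val
  | 0, v => by simp [boolFunEquivFin]
  | L + 1, v => by
    rw [List.ofFn_succ, bitsToNat_cons, bitsToNat_ofFn]
    change (v 0).toNat + 2 * ((finFunctionFinEquiv fun i : Fin L => finTwoEquiv.symm (v i.succ)) : ℕ) =
      ((finFunctionFinEquiv fun i : Fin (L + 1) => finTwoEquiv.symm (v i)) : ℕ)
    rw [finFunctionFinEquiv_apply, finFunctionFinEquiv_apply, Fin.sum_univ_succ]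
    simp only [Fin.val_zero, pow_zero, mul_one, Fin.val_succ, pow_succ]
    rw [Finset.mul_sum]
    congr 1
    · cases v 0 <;> rfl
    · exact Finset.sum_congr rfl fun i _ => by ring

/-- The first `m` listed values. [folklore] -/
theorem take_ofFn_castLE {α : Type*} {L m : ℕ} (hm : m ≤ L) (u : Fin L → α) :
    (List.ofFn u).take m = List.ofFn fun i : Fin m => u (Fin.castLE hm i) := by
  apply List.ext_getElem
  · simp [hm]
  · intro i h1 h2
    simp only [List.getElem_take, List.getElem_ofFn]
    rfl

/-- **The cube function of a truth table is the padded source function**: read through the row-major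
listing, `tableFn m (truthTable f₀)` is `MildHardFn.srcFn f₀ η hm`. [cite: AroraBarakCC2009, Thm. 19.21 (proof: padding)] -/
theorem cubeFnOf_tableFn {m : ℕ} (f₀ : (Fin m → Bool) → Bool) (η : ℕ) (hm : m ≤ MildHard.nOf η) :
    cubeFnOf η (MildHard.kOf η) (tableFn m (truthTable f₀)) = MildHardFn.srcFn f₀ η hm := by
  funext a
  unfold cubeFnOf MildHardFn.srcFn MildHardFn.padFn tableFn
  have hm' : m ≤ MildHard.kOf η * η := hm
  rw [take_ofFn_castLE hm', bitsToNat_ofFn]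
  rw [truthTable, List.getD_eq_getElem _ _ (by simp), List.getElem_ofFn]
  simp only [Fin.eta, Equiv.symm_apply_apply]
  rfl

/-- **The core brick computes the mildly hard function of the table's function**: on
`⟨List.ofFn w', tctx N m (truthTable f₀)⟩` with fuel `N ≥ 2^{lenOf η}` the answer is
`[MildHardFn.mildFn f₀ η hm w']`. [cite: ImpagliazzoKabanetsWigderson2002, Thm. 11] [cite: AroraBarakCC2009, Thm. 19.21] -/
theorem coreTF_ofFn {m : ℕ} (f₀ : (Fin m → Bool) → Bool) (η : ℕ) (hm : m ≤ MildHard.nOf η)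
    (w' : Fin (MildHard.lenOf η) → Bool) {N : ℕ} (hN : 2 ^ MildHard.lenOf η ≤ N) :
    coreTF (boolPair (List.ofFn w') (tctx N m (truthTable f₀))) = [MildHardFn.mildFn f₀ η hm w'] := by
  have hlen : (List.ofFn w').length = MildHard.lenOf η := List.length_ofFn ..
  rw [coreTF_apply (List.ofFn w') (by rw [hlen]; exact hN) m (truthTable f₀),
    hardBitT_eq m (truthTable f₀) (List.ofFn w') hlen (etaOf_lenOf η) le_rfl, cubeFnOf_tableFn f₀ η hm]
  unfold MildHardFn.mildFn
  congr 2
  funext q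
  exact getD_ofFn_fin w' false _

end Ident

end IKWGenM

end Literature.Computability.Complexity

end
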